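import Mathlib.LinearAlgebra.Matrix.Charpoly.Coeff
import Mathlib.LinearAlgebra.Matrix.GeneralLinearGroup.Defs
import Mathlib.NumberTheory.Padics.Complex
import HarnessLib

/-!
# Block-triangular charpoly reduction (stub T8b `stub_blockTriangularCharpolyReduction`) — line `sector-klingen-split`

Stub-worker of lead prover-line-stmt-Langlands-13639-c4-0 (cycle 4, 2026-08-17), crux `ResiduallyYoshidaLifting`
(stmt-Langlands-13639), route `PhantomRMYoshida`.  Charpoly bookkeeping for the lead's theorem "every symplectic realiser of a
non-trivial class is irreducible": an integral block UPPER-triangular frame `r' g = (T g, C g; 0, τ' g)` over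
`ℤ̄_p = Valued.integer (PadicAlgCl p)` (blocks along `finSumFinEquiv : Fin 2 ⊕ Fin 2 ≃ Fin 4`) whose reduction through
`red : ℤ̄_p →+* k` is conjugate (by `W`, then `h`) to the block upper-triangular residual representation `(σ g, B g; 0, σ' g)`,
and whose top block is residually conjugate to `σ` (`σ g · Ab = Ab · red (T g)`), has bottom block with the characteristic
polynomials of `σ'`: `charpoly (red (τ' g)) = charpoly (σ' g)`.

Proof (pointwise in `g`, pure linear algebra over any commutative ring `O` reducing to a field `k`,
`charpoly_lower_block_of_conj`):
* block-triangular characteristic polynomials multiply (`Matrix.charpoly_fromBlocks_zero₂₁`, `Matrix.charpoly_reindex`) and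
  `map red` commutes with `reindex` / `fromBlocks`, so `charpoly (red (r' g)) = charpoly (red (T g)) · charpoly (red (τ' g))`;
* the characteristic polynomial is a conjugation invariant (`Matrix.charpoly_units_conj`), so hypothesis 2 gives
  `charpoly (red (r' g)) = charpoly (σ g) · charpoly (σ' g)` and hypothesis 3 gives `charpoly (red (T g)) = charpoly (σ g)`;
* cancel the monic, hence non-zero, factor `charpoly (σ g)` in the domain `k[X]`.

No new definitions; the helper lemma is private.
-/

noncomputable section

open scoped Matrix

set_option linter.dupNamespace false
set_option autoImplicit false

namespace Summit.Langlands.Langlands.Cruxes.ResiduallyYoshidaLifting.SectorKlingenSplit.Fibre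

/-- Pure linear algebra behind `stub_blockTriangularCharpolyReduction`, over any commutative ring `O` with a ring map
`red : O →+* k` to a field: if the reduction of the block upper-triangular `(T, C; 0, τ')` is conjugate to the block
upper-triangular `(s, B; 0, s')` and `red T` is conjugate to `s`, then `charpoly (red τ') = charpoly s'` (block-triangular
charpolys multiply, charpoly is a conjugation invariant, and the monic `charpoly s` cancels in `k[X]`). [folklore] -/
private theorem charpoly_lower_block_of_conj {O k : Type*} [CommRing O] [Field k] (red : O →+* k)
    (s s' : GL (Fin 2) k) (B : Matrix (Fin 2) (Fin 2) k) (h W : GL (Fin 4) k) (Ab : GL (Fin 2) k)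
    (T C τ' : Matrix (Fin 2) (Fin 2) O) (r' : Matrix (Fin 4) (Fin 4) O)
    (h1 : r' = Matrix.reindex finSumFinEquiv finSumFinEquiv (Matrix.fromBlocks T C 0 τ'))
    (h2 : r'.map red = W.val * (h.val * Matrix.reindex finSumFinEquiv finSumFinEquiv
          (Matrix.fromBlocks s.val B 0 s'.val) * (h⁻¹).val) * (W⁻¹).val)
    (h3 : s.val * Ab.val = Ab.val * T.map red) :
    (τ'.map red).charpoly = s'.val.charpoly := by
  -- (1) block-triangular charpolys multiply, and `map red` commutes with `reindex` / `fromBlocks`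
  have hblocks : (r'.map red).charpoly = (T.map red).charpoly * (τ'.map red).charpoly := by
    have hmap : r'.map red =
        Matrix.reindex finSumFinEquiv finSumFinEquiv (Matrix.fromBlocks (T.map red) (C.map red) 0 (τ'.map red)) := by
      rw [h1, Matrix.reindex_apply, Matrix.reindex_apply, ← Matrix.submatrix_map, Matrix.fromBlocks_map,
        Matrix.map_zero _ (map_zero red)]
    rw [hmap, Matrix.charpoly_reindex, Matrix.charpoly_fromBlocks_zero₂₁]
  -- (2) the reduction is conjugate to `(s, B; 0, s')`
  have hconj : (r'.map red).charpoly = s.val.charpoly * s'.val.charpoly := by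
    rw [h2, Matrix.coe_units_inv, Matrix.coe_units_inv, Matrix.charpoly_units_conj, Matrix.charpoly_units_conj,
      Matrix.charpoly_reindex, Matrix.charpoly_fromBlocks_zero₂₁]
  -- (3) the top block is conjugate to `s`
  have htop : (T.map red).charpoly = s.val.charpoly := by
    have hT : T.map red = Ab.val⁻¹ * s.val * Ab.val := by
      rw [mul_assoc, h3, Matrix.nonsing_inv_mul_cancel_left _ _ (Matrix.isUnits_det_units Ab)]
    rw [hT, Matrix.charpoly_units_conj']
  -- (4) cancel the monic factor `charpoly s` in the domain `k[X]`
  rw [hconj, htop] at hblocks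
  exact mul_left_cancel₀ (Matrix.charpoly_monic s.val).ne_zero hblocks.symm

/-- **Registered statement `stub_blockTriangularCharpolyReduction`** (T8b; charpoly bookkeeping for T8-plane): an integral block
UPPER-triangular family `r' g = (T g, C g; 0, τ' g)` over `ℤ̄_p` whose reduction through `red` is conjugate to the realised
`h (σ̄, B; 0, σ̄') h⁻¹`, with top block residually conjugate to `σ̄` (orientation), has bottom block with the characteristic
polynomials of `σ̄'`: `charpoly (red τ' g) = charpoly σ̄'(g)` (block-triangular charpolys multiply; cancel the monic `charpoly σ̄(g)`
in `k[X]`). [folklore] -/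
theorem stub_blockTriangularCharpolyReduction :
    ∀ (p : ℕ) [Fact p.Prime] (k : Type) [Field k] (Γ : Type)
      (red : Valued.integer (PadicAlgCl p) →+* k) (σ σ' : Γ → GL (Fin 2) k) (B : Γ → Matrix (Fin 2) (Fin 2) k)
      (h W : GL (Fin 4) k) (Ab : GL (Fin 2) k)
      (T C τ' : Γ → Matrix (Fin 2) (Fin 2) (Valued.integer (PadicAlgCl p)))
      (r' : Γ → Matrix (Fin 4) (Fin 4) (Valued.integer (PadicAlgCl p))),
      (∀ g, r' g = Matrix.reindex finSumFinEquiv finSumFinEquiv (Matrix.fromBlocks (T g) (C g) 0 (τ' g))) →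
      (∀ g, (r' g).map red = W.val * (h.val * Matrix.reindex finSumFinEquiv finSumFinEquiv
            (Matrix.fromBlocks (σ g).val (B g) 0 (σ' g).val) * (h⁻¹).val) * (W⁻¹).val) →
      (∀ g, (σ g).val * Ab.val = Ab.val * (T g).map red) →
      ∀ g, ((τ' g).map red).charpoly = (σ' g).val.charpoly := by
  intro p _ k _ Γ red σ σ' B h W Ab T C τ' r' h1 h2 h3 g
  exact charpoly_lower_block_of_conj red (σ g) (σ' g) (B g) h W Ab (T g) (C g) (τ' g) (r' g) (h1 g) (h2 g) (h3 g)

end Summit.Langlands.Langlands.Cruxes.ResiduallyYoshidaLifting.SectorKlingenSplit.Fibre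

end
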